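import Mathlib.Analysis.Calculus.MeanValue
import Literature.Analysis.UnboundedOperators.HeatKernelBoundedData
import Literature.Analysis.UnboundedOperators.HeatKernelSmooth
import HarnessLib

/-!
# The Liouville theorem for bounded ancient solutions of the heat equation (semigroup form)

Analysis/UnboundedOperators support file (all results proved). A bounded function `u` on
`(−∞, 0) × E` which is propagated by the heat semigroup, `u(t) = e^{ν(t−s)Δ} u(s)` for all
`s < t < 0` (a *bounded ancient caloric function* in mild form), is constant in space and time.
Proof: by the sup-norm gradient estimate `‖∇e^{σΔ}f‖_∞ ≤ 2^{n/2} σ^{-1/2} ‖f‖_∞`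
(`norm_fderiv_heatExtension_le_of_bounded`, Giga–Giga–Saal 2010, §1.1.3) and the mean value
inequality, `‖u(t, y) − u(t, x)‖ ≤ 2^{n/2} (ν(t − s))^{-1/2} C ‖y − x‖` for every `s < t`, and
`s → −∞` makes every slice constant; a constant datum is preserved by the heat semigroup
(`heatExtension_const`), so the constants agree.

This is the ingredient "`w₂` is a bounded ancient caloric function, hence constant" of Step 5 of
the proof of Koch–Nadirashvili–Seregin–Šverák 2009, Theorem 6.2 (arXiv:0709.3599 p. 13: after
`(w₁, w₃) = 0`, "this easily implies that `w = 0`"; decomposition in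
`Literature/Analysis/FluidPDE/KNSSTypeIRate.lean`), and the parabolic counterpart of the
classical Liouville theorem.

## References

* D. V. Widder, *The Heat Equation* (Academic Press 1975), Ch. VIII (uniqueness and
  representation of bounded/positive temperatures); the statement is folklore.
* M.-H. Giga, Y. Giga, J. Saal, *Nonlinear Partial Differential Equations* (Birkhäuser 2010),
  §1.1.3 (the `L^p`–`L^q` and gradient estimates of the heat semigroup). [GigaGigaSaal2010]
* G. Koch, N. Nadirashvili, G. Seregin, V. Šverák, Acta Math. 203 (2009) = arXiv:0709.3599,
  proof of Theorem 6.2, p. 13. [KochNadirashviliSereginSverak2009]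
-/

noncomputable section

open MeasureTheory Set Filter
open scoped ENNReal

namespace Literature.Analysis.UnboundedOperators

variable {E : Type*} [NormedAddCommGroup E] [InnerProductSpace ℝ E] [FiniteDimensional ℝ E]
  [MeasurableSpace E] [BorelSpace E]
variable {F : Type*} [NormedAddCommGroup F] [NormedSpace ℝ F] [CompleteSpace F]

/-- **Lipschitz bound for a slice propagated from time `s`.** If `‖f‖ ≤ C` (`f` measurable) and
`σ > 0`, then `‖e^{σΔ}f(y) − e^{σΔ}f(x)‖ ≤ 2^{n/2} σ^{-1/2} C ‖y − x‖` (mean value inequality with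
the sup-norm gradient estimate of Giga–Giga–Saal 2010, §1.1.3). [cite: GigaGigaSaal2010, §1.1.3] -/
theorem norm_heatExtension_sub_le_of_bounded {f : E → F} (hf : AEStronglyMeasurable f volume)
    {C : ℝ} (hC : ∀ z, ‖f z‖ ≤ C) {σ : ℝ} (hσ : 0 < σ) (x y : E) :
    ‖heatExtension f σ y - heatExtension f σ x‖ ≤
      (2 : ℝ) ^ ((Module.finrank ℝ E : ℝ) / 2) * σ ^ (-(1 / 2 : ℝ)) * C * ‖y - x‖ := by
  have hmem : MemLp f ∞ (volume : Measure E) := memLp_top_of_bound hf C (Eventually.of_forall hC)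
  have hdiff : Differentiable ℝ (heatExtension f σ) :=
    (contDiff_heatExtension_holds hmem le_top hσ).differentiable (by simp)
  exact Convex.norm_image_sub_le_of_norm_fderiv_le (fun z _ => hdiff.differentiableAt)
    (fun z _ => norm_fderiv_heatExtension_le_of_bounded hf hC hσ z) convex_univ (mem_univ x)
    (mem_univ y)

/-- **Liouville theorem for bounded ancient caloric functions (semigroup form).** Let `ν > 0`
and let `u : ℝ → E → F` have measurable slices bounded by `C` on `(−∞, 0) × E` and satisfy
`u(t) = e^{ν(t−s)Δ} u(s)` pointwise for all `s < t < 0`. Then `u` is constant on `(−∞, 0) × E`: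
`u(s, x) = u(t, y)` for all `s, t < 0` and all `x, y`. (Slices: `‖u(t,y) − u(t,x)‖ ≤
2^{n/2}(ν(t − s))^{-1/2} C ‖y − x‖ → 0` as `s → −∞`, `norm_heatExtension_sub_le_of_bounded`; time:
`e^{σΔ} c = c`, `heatExtension_const`.) [folklore] -/
theorem heat_liouville_ancient {ν : ℝ} (hν : 0 < ν) {u : ℝ → E → F}
    (hmeas : ∀ t < 0, AEStronglyMeasurable (u t) volume) {C : ℝ} (hC : ∀ t < 0, ∀ x, ‖u t x‖ ≤ C)
    (hsemi : ∀ s t : ℝ, s < t → t < 0 → ∀ x, u t x = heatExtension (u s) (ν * (t - s)) x) :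
    ∀ s t : ℝ, s < 0 → t < 0 → ∀ x y : E, u s x = u t y := by
  set K : ℝ := (2 : ℝ) ^ ((Module.finrank ℝ E : ℝ) / 2) with hK
  have hK0 : 0 < K := by positivity
  -- Step 1: every slice is constant
  have hslice : ∀ t < 0, ∀ x y : E, u t x = u t y := by
    intro t ht x y
    -- the bound from time `s = t - σ/ν`, for every `σ > 0`
    have hbd : ∀ σ : ℝ, 0 < σ → ‖u t y - u t x‖ ≤ K * σ ^ (-(1 / 2 : ℝ)) * C * ‖y - x‖ := by
      intro σ hσ
      set s : ℝ := t - σ / ν with hs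
      have hst : s < t := by
        have : 0 < σ / ν := div_pos hσ hν
        linarith
      have hs0 : s < 0 := hst.trans ht
      have e : ν * (t - s) = σ := by rw [hs]; field_simp; ring
      have key := norm_heatExtension_sub_le_of_bounded (hmeas s hs0) (hC s hs0) hσ x y
      rwa [← e, ← hsemi s t hst ht x, ← hsemi s t hst ht y, e] at key
    -- let `σ → ∞`
    by_contra hne
    have hpos : 0 < ‖u t y - u t x‖ := norm_pos_iff.2 (sub_ne_zero.2 (Ne.symm hne))
    have hC0 : 0 ≤ C := (norm_nonneg _).trans (hC t ht x)
    set D : ℝ := K * C * ‖y - x‖ with hD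
    have hD0 : 0 ≤ D := by positivity
    -- choose `σ` with `D σ^{-1/2} ≤ ‖u t y - u t x‖ / 2`
    set ε : ℝ := ‖u t y - u t x‖ / 2 with hε
    have hε0 : 0 < ε := by positivity
    set σ : ℝ := (D / ε) ^ 2 + 1 with hσdef
    have hσ : 0 < σ := by positivity
    have hsqrt : D / ε ≤ Real.sqrt σ := by
      rw [hσdef]
      calc D / ε = Real.sqrt ((D / ε) ^ 2) := (Real.sqrt_sq (by positivity)).symm
        _ ≤ Real.sqrt ((D / ε) ^ 2 + 1) := Real.sqrt_le_sqrt (by linarith)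
    have hrpow : σ ^ (-(1 / 2 : ℝ)) = (Real.sqrt σ)⁻¹ := by
      rw [Real.rpow_neg hσ.le, Real.sqrt_eq_rpow]
    have hsσ : 0 < Real.sqrt σ := Real.sqrt_pos.2 hσ
    have h1 : D * (Real.sqrt σ)⁻¹ ≤ ε := by
      rw [← div_eq_mul_inv, div_le_iff₀ hsσ]
      calc D = ε * (D / ε) := by field_simp
        _ ≤ ε * Real.sqrt σ := mul_le_mul_of_nonneg_left hsqrt hε0.le
    have h2 := hbd σ hσ
    rw [hrpow] at h2
    have h3 : K * (Real.sqrt σ)⁻¹ * C * ‖y - x‖ = D * (Real.sqrt σ)⁻¹ := by rw [hD]; ring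
    rw [h3] at h2
    have : ‖u t y - u t x‖ ≤ ε := h2.trans h1
    rw [hε] at this
    linarith
  -- Step 2: the constants of different slices agree
  have htime : ∀ s t : ℝ, s < t → t < 0 → u t 0 = u s 0 := by
    intro s t hst ht
    have hs0 : s < 0 := hst.trans ht
    have hus : u s = fun _ => u s 0 := funext fun x => hslice s hs0 x 0
    have hσ : 0 < ν * (t - s) := mul_pos hν (by linarith)
    rw [hsemi s t hst ht 0, hus, heatExtension_const _ hσ]
  intro s t hs ht x y
  rw [hslice s hs x 0, hslice t ht y 0]
  rcases lt_trichotomy s t with h | h | h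
  · exact (htime s t h ht).symm
  · rw [h]
  · exact htime t s h hs

end Literature.Analysis.UnboundedOperators

end
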